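import Literature.Analysis.FluidPDE.TypeIAncientMild
import Literature.Analysis.FluidPDE.OseenMildUniqueness
import Literature.Analysis.FluidPDE.KNSSOseenMildDecayTools
import Literature.Analysis.FluidPDE.KatoSymmetryCovariance
import HarnessLib

/-!
# Crux `ClockStretchingLaw.ClockCeiling` (stmt-NavierStokesRegularity-10570), line `registered`:
# stub `stub_translationInvariantAfter` — translation invariance of a slice propagates forward

For an element `u` of the Type-I ancient mild class `A_C = IsTypeIAncientMild C u` (jointly smooth
on `(-∞,0) × ℝ³`, divergence-free slices, the Oseen integral identity
`u t = e^{(t-s)Δ} u s - B¹_s(u,u)(t)` between all pairs `s < t < 0`, `‖u(t,x)‖ ≤ C/√(-t)`; NO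
symmetry): if ONE slice `u s` (`s < 0`) is invariant under the translation `x ↦ x + b`, then
every later slice `u t`, `s < t < 0`, is invariant under it.

Proof (the step "symmetries of the data are inherited by the unique solution", here for the
Oseen integral equation; Koch–Nadirashvili–Seregin–Šverák 2009, §1 p. 3 (symmetries) and §3–§4
(uniqueness of bounded mild solutions by the fixed point in `L^∞_{x,t}`)):

* `translationInvariantAfter_isTypeIAncientMild_comp_add_right` — the translate
  `v(τ, y) = u(τ, y + b)` is again in `A_C` (the heat flow and the Oseen–Duhamel term commute with
  translations: `heatFlow_comp_add_right`, `oseenDuhamel_comp_add_right`; smoothness, the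
  divergence condition and the `x`-uniform Type-I bound are translation covariant);
* on the slab `(s, t/2) × ℝ³` (`t < t/2 < 0`) both `u` and `v` are bounded by `C/√(-(t/2))`,
  jointly measurable, and solve the SAME integral equation from time `s`, because the free terms
  agree: `v s = u s` by the hypothesis. Uniqueness of bounded solutions of the Oseen integral
  equation (`oseenMild_bounded_unique`) gives `u t = v t` a.e., and continuity of both slices
  upgrades this to equality everywhere.

References: G. Koch, N. Nadirashvili, G. Seregin, V. Šverák, *Liouville theorems for the
Navier–Stokes equations and applications*, Acta Math. 203 (2009) = arXiv:0709.3599, §1 p. 3,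
§3 p. 6, §4 p. 8.
-/

-- the summit and its single sub-problem share the name (CONVENTIONS §1), as in every Theorems file
set_option linter.dupNamespace false

noncomputable section

namespace Summit.NavierStokesRegularity.NavierStokesRegularity.Theorems

open Set Function Filter MeasureTheory
open Literature.Analysis Literature.Analysis.FluidPDE

/-- **`A_C` is invariant under space translations** `u ↦ u(·, · + c)` (same constant): joint
smoothness and the divergence condition are translation covariant, the heat flow and the
Oseen–Duhamel term commute with translations (`heatFlow_comp_add_right`,
`oseenDuhamel_comp_add_right`), and the Type-I bound is uniform in `x` (KNSS 2009, §1 p. 3: the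
symmetries of the problem). [cite: KochNadirashviliSereginSverak2009, §1 p. 3 (arXiv:0709.3599)] -/
theorem translationInvariantAfter_isTypeIAncientMild_comp_add_right {C : ℝ}
    {u : ℝ → EuclideanSpace ℝ (Fin 3) → EuclideanSpace ℝ (Fin 3)} (h : IsTypeIAncientMild C u)
    (c : EuclideanSpace ℝ (Fin 3)) : IsTypeIAncientMild C (fun t x => u t (x + c)) := by
  refine ⟨?_, fun t ht => (h.isDivFree ht).comp_add_right c, fun s t hst ht x => ?_,
    fun t ht x => h.norm_le ht (x + c)⟩
  · have e : (uncurry fun t x => u t (x + c)) =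
        uncurry u ∘ fun p : ℝ × EuclideanSpace ℝ (Fin 3) => (p.1, p.2 + c) := by
      funext p
      rfl
    rw [e]
    refine h.contDiffOn.comp
      ((contDiff_fst.prodMk (contDiff_snd.add contDiff_const)).contDiffOn) ?_
    intro p hp
    exact mem_prod.2 ⟨(mem_prod.1 hp).1, mem_univ _⟩
  · show u t (x + c) = heatFlow (fun y => u s (y + c)) (t - s) x -
        oseenDuhamel 1 s (fun τ y => u τ (y + c)) (fun τ y => u τ (y + c)) t x
    rw [heatFlow_comp_add_right, oseenDuhamel_comp_add_right]
    exact h.mild_eq hst ht (x + c)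

/-- **Stub `stub_translationInvariantAfter` — translation invariance of one slice propagates
forward in `A_C`.** For `u ∈ A_C`, `s < 0`, `b ∈ ℝ³` with `u(s, x + b) = u(s, x)` for all `x`:
`u(t, x + b) = u(t, x)` for all `s < t < 0` and all `x`. Proof: the translate
`v(τ, y) = u(τ, y + b)` lies in `A_C` (`translationInvariantAfter_isTypeIAncientMild_comp_add_right`)
and has the same slice at time `s`; on the slab `(s, t/2) × ℝ³` both fields are bounded by
`C/√(-(t/2))`, jointly measurable, and solve the same Oseen integral equation from time `s`, so
`u t = v t` a.e. by uniqueness of bounded Oseen-mild solutions (`oseenMild_bounded_unique`,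
KNSS 2009 §3–§4), hence everywhere by continuity of the two slices. [cite: KochNadirashviliSereginSverak2009, §1 p. 3 and §4 (4.3)–(4.4) (arXiv:0709.3599 p. 8)] -/
theorem stub_translationInvariantAfter : ∀ (C : ℝ) (u : ℝ → EuclideanSpace ℝ (Fin 3) → EuclideanSpace ℝ (Fin 3)), Literature.Analysis.FluidPDE.IsTypeIAncientMild C u → ∀ (s : ℝ) (b : EuclideanSpace ℝ (Fin 3)), s < 0 → (∀ x, u s (x + b) = u s x) → ∀ t : ℝ, s < t → t < 0 → ∀ x, u t (x + b) = u t x := by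
  intro C u h s b _hs hb t hst ht x
  -- the translate `v τ y = u τ (y + b)` is again in the class, with the same slice at time `s`
  have hv : IsTypeIAncientMild C (fun τ y => u τ (y + b)) :=
    translationInvariantAfter_isTypeIAncientMild_comp_add_right h b
  have hvs : (fun y => u s (y + b)) = u s := funext hb
  -- the slab `(s, t / 2)`
  have hT0 : t / 2 < 0 := by linarith
  have htI : t ∈ Ioo s (t / 2) := ⟨hst, by linarith⟩
  have hM : 0 ≤ C / Real.sqrt (-(t / 2)) := div_nonneg h.nonneg (Real.sqrt_nonneg _)
  have huM : ∀ τ ∈ Ioo s (t / 2), ∀ y, ‖u τ y‖ ≤ C / Real.sqrt (-(t / 2)) :=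
    fun τ hτ y => h.norm_le_of_mem_Ioo hT0 hτ y
  have hvM : ∀ τ ∈ Ioo s (t / 2), ∀ y,
      ‖(fun τ y => u τ (y + b)) τ y‖ ≤ C / Real.sqrt (-(t / 2)) :=
    fun τ hτ y => hv.norm_le_of_mem_Ioo hT0 hτ y
  have hum := h.aestronglyMeasurable_uncurry (s := s) hT0.le
  have hvm := hv.aestronglyMeasurable_uncurry (s := s) hT0.le
  -- the two integral equations with the common free term `e^{(τ-s)Δ} u(s)`
  have hu : ∀ τ ∈ Ioo s (t / 2), u τ =ᵐ[volume] fun y =>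
      UnboundedOperators.heatExtension (u s) (τ - s) y - oseenDuhamel 1 s u u τ y :=
    fun τ hτ => Eventually.of_forall fun y => h.mild_eq_heatExtension hτ.1 (hτ.2.trans hT0) y
  have hv' : ∀ τ ∈ Ioo s (t / 2), (fun τ y => u τ (y + b)) τ =ᵐ[volume] fun y =>
      UnboundedOperators.heatExtension (u s) (τ - s) y -
        oseenDuhamel 1 s (fun τ y => u τ (y + b)) (fun τ y => u τ (y + b)) τ y := by
    intro τ hτ
    refine Eventually.of_forall fun y => ?_
    have key := hv.mild_eq_heatExtension hτ.1 (hτ.2.trans hT0) y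
    rw [hvs] at key
    exact key
  have hae := oseenMild_bounded_unique one_pos hM hum hvm huM hvM hu hv' t htI
  have heq := (Continuous.ae_eq_iff_eq volume (h.continuous_slice ht) (hv.continuous_slice ht)).1 hae
  exact (congr_fun heq x).symm

end Summit.NavierStokesRegularity.NavierStokesRegularity.Theorems

end
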